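import Summits.QuantumFields.Balaban3D.Carriers.OldTerms

/-!
# Bałaban CMP 102 (1985) 255–275, d = 3 — prover seat p6 (lane `pub-balaban3d`): the BLOCK COUNT of the newborn
# slice of (46) — `#(big blocks of Ω_{k+1}(h)) ≤ L^d·|Λ_{k+1}(h)|` («Summation over y gives the factor
# (M₁L^jη)^{−3}|Λ_k|», p. 267 L10), [folklore] combinatorics over seat p1's DEFINED regions `Carriers.ΩblkOf`
# (ruling R-OMEGA) and `Carriers.LamFin` (ruling R-LAMVOL)

Source: T. Bałaban, Commun. Math. Phys. **102** (1985) 255–275 [Balaban1985UV3] (= [B10]), p. 267 L10–12 (46) and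
p. 266 L27–29 (43) «y represents big blocks of L^jη-lattice, contained in Ω_k» (text layer `p0013.txt`/`p0012.txt`).
HONEST FRAMING (lane PLAN.md §0): nothing of the paper is asserted; NOT a continuum limit, NOT infinite volume, NOT a
mass gap, NOT d = 4, NOT Clay.  Additive over the frozen carriers (v1.3b); seat p1 may re-home it.  Consumer: the
sibling `…Proofs.Run3Newborn` (lane ruling R-46N).  PLACEMENT: `Summits/QuantumFields/Balaban3D/Proofs/`.
-/

open Finset
open Literature.MathematicalPhysics.QuantumFieldTheory.Balaban1983to89
open Summit.QuantumFields.Balaban3D.Carriers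

namespace Summit.QuantumFields.Balaban3D.Proofs.NewbornCount

section Count

variable {P : Params} (M₁ : ℕ) (Rcol : ℕ → ℕ)

/-- Elementary: a label `v < max 1 ⌊spd/M₁⌋` scales back into the lattice, `v·M₁ < spd` (`spd ≥ 2`). [folklore] -/
theorem val_mul_lt_sitesPerDir {k v : ℕ} (hv : v < max 1 (P.sitesPerDir k / M₁)) :
    v * M₁ < P.sitesPerDir k := by
  have hspd : 1 < P.sitesPerDir k := P.one_lt_sitesPerDir k
  rcases Nat.eq_zero_or_pos M₁ with hM | hM
  · rw [hM, mul_zero]; omega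
  rcases Nat.eq_zero_or_pos v with hv0 | hv0
  · rw [hv0, zero_mul]; omega
  have hvq : v < P.sitesPerDir k / M₁ := by
    rcases lt_max_iff.1 hv with h1 | h2
    · omega
    · exact h2
  have h2 : (v + 1) * M₁ ≤ P.sitesPerDir k := (Nat.le_div_iff_mul_le hM).1 hvq
  calc v * M₁ < v * M₁ + M₁ := Nat.lt_add_of_pos_right hM
    _ = (v + 1) * M₁ := by ring
    _ ≤ P.sitesPerDir k := h2

/-- The site of `T^{(k)}` at the lowest corner of the big block with label `b` (coordinates `b_μ·M₁`). [folklore] -/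
def cornerSite {k : ℕ} (N : ℕ) (b : Fin P.d → ZMod N) : Site P k :=
  fun μ => ((((b μ).val * M₁ : ℕ)) : ZMod (P.sitesPerDir k))

/-- The corner site has coordinates `b_μ·M₁` (no wrap-around for labels below `max 1 ⌊spd/M₁⌋`). [folklore] -/
theorem val_cornerSite {k : ℕ} (N : ℕ) [NeZero N] (hN : N = max 1 (P.sitesPerDir k / M₁)) (b : Fin P.d → ZMod N)
    (μ : Fin P.d) : ((cornerSite M₁ N b : Site P k) μ).val = (b μ).val * M₁ := by
  show (((((b μ).val * M₁ : ℕ)) : ZMod (P.sitesPerDir k))).val = _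
  rw [ZMod.val_natCast, Nat.mod_eq_of_lt]
  exact val_mul_lt_sitesPerDir M₁ ((ZMod.val_lt (b μ)).trans_eq hN)

/-- The big-block label of (every fine site over) the corner site of `b` is `b`. [folklore] -/
theorem bigBlockOf_of_coarsen_eq_cornerSite {k : ℕ} (N : ℕ) [NeZero N] (hN : N = max 1 (P.sitesPerDir k / M₁))
    (b : Fin P.d → ZMod N) {x : Site P 0} (hx : coarsen k x = cornerSite M₁ N b) :
    bigBlockOf M₁ k x = fun μ => (b μ).val := by
  funext μ
  show ((coarsen k x) μ).val / M₁ = (b μ).val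
  rw [hx, val_cornerSite M₁ N hN b μ]
  rcases Nat.eq_zero_or_pos M₁ with hM | hM
  · -- `M₁ = 0`: one label only (`N = 1`)
    have hN1 : N = 1 := by rw [hN, hM, Nat.div_zero]; rfl
    have hb : (b μ).val < 1 := (ZMod.val_lt (b μ)).trans_eq hN1
    rw [hM, mul_zero, Nat.zero_div]; omega
  · exact Nat.mul_div_cancel _ hM

/-- `cornerSite` is injective on labels. [folklore] -/
theorem cornerSite_injective {k : ℕ} (N : ℕ) [NeZero N] (hN : N = max 1 (P.sitesPerDir k / M₁)) :
    Function.Injective (fun b : Fin P.d → ZMod N => (cornerSite M₁ N b : Site P k)) := by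
  intro b b' hbb'
  funext μ
  have hμ := congrArg (fun z : Site P k => (z μ).val) hbb'
  simp only at hμ
  rw [val_cornerSite M₁ N hN b μ, val_cornerSite M₁ N hN b' μ] at hμ
  rcases Nat.eq_zero_or_pos M₁ with hM | hM
  · have hN1 : N = 1 := by rw [hN, hM, Nat.div_zero]; rfl
    subst hN1
    exact Subsingleton.elim _ _
  · exact ZMod.val_injective N (Nat.eq_of_mul_eq_mul_right hM hμ)

/-- **«Summation over y gives the factor (M₁L^jη)^{−3}|Λ_k|»** (p. 267 L10), the lane's count at the top scale:
the number of scale-`k` big blocks of `B(Λ_{k+1}(h)) = Ω_{k+1}(h)^{(k)}` (seat p1's `ΩblkOf`, ruling R-OMEGA, with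
`N = max 1 ⌊spd_k/M₁⌋` labels per direction = `nblkOf`) is at most `L^d` times the number of sites of `T^{(k+1)}` in
`Ω_{k+1}(h)` (`|Λ_{k+1}(h)| = #LamFin`, ruling R-LAMVOL): each block's corner site lies in `Ω_{k+1}(h)` and at most
`L^d` corner sites share a site of `T^{(k+1)}` (`Site.card_block`).  Standing range `k + 1 ≤ m + K`.  (The sharp
count has `(L/M₁)^d`; the `M₁`-power is not load-bearing, LQB census C-B10-1.) [cite: Balaban1985UV3, (46) p.267 + (43) p.266] -/
theorem card_ΩblkOf_le {k : ℕ} (hk : k + 1 ≤ P.m + P.K) (N : ℕ) [NeZero N]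
    (hN : N = max 1 (P.sitesPerDir k / M₁)) (h : Hist P (k + 1)) :
    (ΩblkOf M₁ Rcol N h).card ≤ P.L ^ P.d * (LamFin M₁ Rcol k h).card := by
  classical
  set f : (Fin P.d → ZMod N) → Site P (k + 1) := fun b => blockOf (cornerSite M₁ N b : Site P k) with hf
  -- every block of `Ω_{k+1}(h)` maps into `Λ_{k+1}(h)`
  have himg : (ΩblkOf M₁ Rcol N h).image f ⊆ LamFin M₁ Rcol k h := by
    intro y hy
    obtain ⟨b, hb, rfl⟩ := Finset.mem_image.1 hy
    rw [mem_lamFin]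
    obtain ⟨x, hx⟩ := coarsen_surjective k (by omega) (cornerSite M₁ N b : Site P k)
    refine ⟨x, by rw [coarsen_succ, hx], ?_⟩
    exact (mem_ΩblkOf M₁ Rcol).1 hb x (bigBlockOf_of_coarsen_eq_cornerSite M₁ N hN b hx)
  -- fibres: at most `L^d` labels over one coarse site (their corner sites lie in its block)
  have hfib : ∀ y ∈ (ΩblkOf M₁ Rcol N h).image f,
      ((ΩblkOf M₁ Rcol N h).filter fun b => f b = y).card ≤ P.L ^ P.d := by
    intro y _
    rw [← Site.card_block hk y]
    refine Finset.card_le_card_of_injOn (fun b => (cornerSite M₁ N b : Site P k)) (fun b hb => ?_)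
      ((cornerSite_injective M₁ N hN).injOn)
    have hby : f b = y := (Finset.mem_filter.1 hb).2
    exact Finset.mem_filter.2 ⟨Finset.mem_univ _, hby⟩
  calc (ΩblkOf M₁ Rcol N h).card ≤ P.L ^ P.d * ((ΩblkOf M₁ Rcol N h).image f).card :=
        Finset.card_le_mul_card_image _ _ hfib
    _ ≤ P.L ^ P.d * (LamFin M₁ Rcol k h).card := Nat.mul_le_mul_left _ (Finset.card_le_card himg)

end Count

end Summit.QuantumFields.Balaban3D.Proofs.NewbornCount
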